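import Summits.ResolutionOfSingularities.ResolutionOfSingularities.Theorems.EquisingularLiftEquisingularLiftNatSpecimenConeJacobianIff
import Summits.ResolutionOfSingularities.ResolutionOfSingularities.Theorems.EquisingularLiftEquisingularLiftNatSpecimenConeForms
import Summits.ResolutionOfSingularities.ResolutionOfSingularities.Theorems.EquisingularLiftEquisingularLiftNatSpecimenFermatConeChartRings
import Summits.ResolutionOfSingularities.ResolutionOfSingularities.Theorems.EquisingularLiftEquisingularLiftNatEBetaVertex
import Literature.AlgebraicGeometry.Resolution.NodalPowRingSingularLocus
import Literature.AlgebraicGeometry.Resolution.RegularLocalRingsJacobian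
import Literature.AlgebraicGeometry.Resolution.ProjectiveSpaceRegular
import Literature.AlgebraicGeometry.Resolution.AlterationsProofs
import Literature.AlgebraicGeometry.Motives.HypersurfaceCharts
import HarnessLib

/-!
# [OURS · L1 W4.5(b)] THE CONE OVER A SMOOTH HYPERSURFACE IS SINGULAR EXACTLY AT ITS VERTEX (ring level, any dimension) — and the
# cone specimens of EL♮ are honest isolated singularities (crux `Theses.EquisingularLift.EquisingularLiftNat`, stmt-20038 / child stmt-20148)

NOT a statement of any manuscript; OURS kernel theorem (cell `res-hironaka`, chain w45b; seat res-D-pv-013, own initiative, counted 0). AI-written,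
weaker than expert review. No definition, no `sorry`, standard axioms.

The EL♮ cone theorems (`Cone.elNatAt_cone` p524856, `elNatAt_cone_of_isNonsingularForm` p526332, `elNatAt_quadricCone` p527817) are sold as
instances with an ISOLATED singular point, the vertex. This file proves that claim at ring level, in the vertex chart `x₀ = 1` whose coordinate
ring is `A/(G)`, `A = K[y₁,…,y_N]`, for EVERY nonsingular form `G` of degree `d ≥ 2` in any number `N = n + 2` of variables:

* `eval_zero_of_isHomogeneous`, `mem_sq_of_forall_X_mem` — a form of degree `≥ 1` vanishes at `0`; a form of degree `≥ 2` lies in `Q²` for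
  every ideal `Q ∋ y₁,…,y_N` (Taylor, tree `mem_ker_eval_sq_of_pderiv_eval_eq_zero`);
* **`not_isRegularLocalRing_of_forall_X_mem`** — at the vertex (`Q ∋` all `yᵢ`) `A_Q/(G)` is NOT regular (`0 ≠ G ∈ Q²`, Matsumura 14.2, tree
  `not_isRegularLocalRing_quotient_span_singleton_of_mem_sq'`);
* **`isRegularLocalRing_of_exists_X_not_mem`** — off the vertex (`Q ∋ G` prime missing some `yᵢ`) `A_Q/(G)` IS regular: by `IsNonsingularForm` some
  partial `∂ⱼG ∉ Q` (Stacks 07PF local form, tree `isRegularLocalRing_quotient_of_derivation`);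
* **`isRegularLocalRing_iff_exists_X_not_mem`** — the dichotomy: `Sing(V(G)) = {0}` in `𝔸ᴺ`, i.e. the affine cone over the smooth projective
  hypersurface `V₊(G)` is singular exactly at its vertex;
* **`not_isRegular_hypersurface_cone`** — scheme level in `ℙ³`: the cone `V₊(G(x₁,x₂,x₃))` over a prime plane form of degree `≥ 2` is NOT a
  regular scheme (the vertex chart `Spec (ChartRing F 0) ≅ Spec K[y]/(G)` is an open subscheme and `(K[y]/(G))_{𝔪₀}` is not regular, tree
  `Resolution.not_isRegularLocalRing_localization_of_pderiv_eval_eq_zero`) — so the cone specimens are NOT covered by the zero-step rung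
  `elNatAt_of_isRegular` (p528875): they are genuine one-step instances.

References: Matsumura 1986 Thm. 14.2; Hartshorne 1977 I Thm. 5.1, I Ex. 5.8; The Stacks Project 07PF.
-/

set_option linter.dupNamespace false -- mandated namespace `Summit.<Summit>.<Problem>` of this single-conjunct summit

noncomputable section

open CategoryTheory AlgebraicGeometry MvPolynomial IsLocalRing
open Literature.AlgebraicGeometry.Resolution
open Literature.AlgebraicGeometry.Motives Literature.AlgebraicGeometry.Motives.SmoothHypersurface
open Summit.ResolutionOfSingularities.ResolutionOfSingularities.Theorems.EquisingularLift.EBeta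

namespace Summit.ResolutionOfSingularities.ResolutionOfSingularities.Cruxes.EquisingularLiftNat.Sections

namespace Cone

variable (K : Type) [Field K]

/-! ## Forms at the origin -/

/-- A form of positive degree vanishes at the origin. [folklore] -/
theorem eval_zero_of_isHomogeneous {σ : Type*} (G : MvPolynomial σ K) {d : ℕ} (hG : G.IsHomogeneous d) (hd : d ≠ 0) :
    eval (0 : σ → K) G = 0 := by
  have h := aeval_smul_eq_pow_mul_aeval hG (0 : K) (0 : σ → K)
  simp only [zero_mul, zero_pow hd] at h
  exact h

/-- The partials of a form of degree `≥ 2` vanish at the origin. [folklore] -/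
theorem eval_zero_pderiv_of_isHomogeneous {σ : Type*} (G : MvPolynomial σ K) {d : ℕ} (hG : G.IsHomogeneous d) (hd : 2 ≤ d) (j : σ) :
    eval (0 : σ → K) (pderiv j G) = 0 :=
  eval_zero_of_isHomogeneous K _ hG.pderiv (by omega)

/-- **A form of degree `≥ 2` lies in `Q²` for every proper ideal `Q` containing all the variables** (Taylor at `0`: `G ∈ 𝔪₀²`, and `𝔪₀ ≤ Q`).
[folklore] -/
theorem mem_sq_of_forall_X_mem {σ : Type*} [Fintype σ] [DecidableEq σ] (G : MvPolynomial σ K) {d : ℕ} (hG : G.IsHomogeneous d)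
    (hd : 2 ≤ d) (Q : Ideal (MvPolynomial σ K)) (hX : ∀ i, (X i : MvPolynomial σ K) ∈ Q) : G ∈ Q ^ 2 := by
  have h0 := mem_ker_eval_sq_of_pderiv_eval_eq_zero (0 : σ → K) (eval_zero_of_isHomogeneous K G hG (by omega))
    (eval_zero_pderiv_of_isHomogeneous K G hG hd)
  refine Ideal.pow_right_mono (I := RingHom.ker (eval (0 : σ → K))) (fun p hp => ?_) 2 h0
  -- `ker (eval 0) ≤ (y₁,…,y_N) ≤ Q`
  have hpX : p ∈ Ideal.span (MvPolynomial.X '' (Set.univ : Set σ) : Set (MvPolynomial σ K)) := by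
    rw [mem_ideal_span_X_image]
    intro m hm
    by_cases hm0 : m = 0
    · subst hm0
      exfalso
      rw [RingHom.mem_ker, eval_zero] at hp
      exact (mem_support_iff.mp hm) (by rwa [← constantCoeff_eq])
    · obtain ⟨i, hi⟩ := Finsupp.ne_iff.mp hm0
      exact ⟨i, Set.mem_univ i, hi⟩
  exact Ideal.span_le.mpr (by rintro _ ⟨i, -, rfl⟩; exact hX i) hpX

/-! ## The vertex is singular -/

/-- **AT THE VERTEX THE CONE IS NOT REGULAR**: for a non-zero form `G ∈ A = K[y₁,…,y_N]` of degree `≥ 2` and a prime `Q` containing all `yᵢ`,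
`A_Q/(G)` is not a regular local ring (`0 ≠ G ∈ Q²A_Q`, Matsumura 14.2). [cite: Matsumura1987, Thm. 14.2] -/
theorem not_isRegularLocalRing_of_forall_X_mem {σ : Type*} [Fintype σ] [DecidableEq σ] (G : MvPolynomial σ K) {d : ℕ}
    (hG : G.IsHomogeneous d) (hd : 2 ≤ d) (hG0 : G ≠ 0) (Q : Ideal (MvPolynomial σ K)) [Q.IsPrime]
    (hX : ∀ i, (X i : MvPolynomial σ K) ∈ Q) :
    ¬ IsRegularLocalRing (Localization.AtPrime Q ⧸
      Ideal.span {algebraMap (MvPolynomial σ K) (Localization.AtPrime Q) G}) := by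
  apply not_isRegularLocalRing_quotient_span_singleton_of_mem_sq'
  · apply mem_nonZeroDivisors_of_ne_zero
    intro h0
    have hinj := IsLocalization.injective (Localization.AtPrime Q) Q.primeCompl_le_nonZeroDivisors
    rw [← map_zero (algebraMap (MvPolynomial σ K) (Localization.AtPrime Q))] at h0
    exact hG0 (hinj h0)
  · rw [← Localization.AtPrime.map_eq_maximalIdeal, ← Ideal.map_pow]
    exact Ideal.mem_map_of_mem _ (mem_sq_of_forall_X_mem K G hG hd Q hX)

/-! ## Off the vertex the cone over a SMOOTH hypersurface is regular -/

/-- **OFF THE VERTEX THE CONE IS REGULAR**: for a nonsingular form `G ∈ K[y₀,…,y_{n+1}]` and a prime `Q ∋ G` missing some variable, `A_Q/(G)`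
is a regular local ring — nonsingularity provides a partial `∂ⱼG ∉ Q`, and Stacks 07PF (local form) applies. [cite: StacksProject, Tag 07PF] -/
theorem isRegularLocalRing_of_exists_X_not_mem {n : ℕ} (G : MvPolynomial (Fin (n + 2)) K) (hns : IsNonsingularForm K G)
    (Q : Ideal (MvPolynomial (Fin (n + 2)) K)) [hQ : Q.IsPrime] (hGQ : G ∈ Q)
    (hne : ∃ i, (X i : MvPolynomial (Fin (n + 2)) K) ∉ Q) :
    IsRegularLocalRing (Localization.AtPrime Q ⧸
      Ideal.span {algebraMap (MvPolynomial (Fin (n + 2)) K) (Localization.AtPrime Q) G}) := by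
  obtain ⟨i, hi⟩ := hne
  have hj : ∃ j, pderiv j G ∉ Q := by
    by_contra h
    push Not at h
    exact hi (hns Q hQ hGQ h i)
  obtain ⟨j, hj⟩ := hj
  exact isRegularLocalRing_quotient_of_derivation _ (pderiv j) Q hGQ hj

/-- **THE AFFINE CONE OVER A SMOOTH PROJECTIVE HYPERSURFACE IS SINGULAR EXACTLY AT ITS VERTEX** (any dimension): for a nonsingular form
`G ∈ A = K[y₀,…,y_{n+1}]` of degree `d ≥ 2` and a prime `Q ∋ G`, the local ring `A_Q/(G)` of the cone `V(G) ⊂ 𝔸ⁿ⁺²` is regular iff `Q` misses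
some variable. [OURS · L1 W4.5b] [folklore] -/
theorem isRegularLocalRing_iff_exists_X_not_mem {n : ℕ} (G : MvPolynomial (Fin (n + 2)) K) {d : ℕ} (hG : G.IsHomogeneous d) (hd : 2 ≤ d)
    (hns : IsNonsingularForm K G) (Q : Ideal (MvPolynomial (Fin (n + 2)) K)) [Q.IsPrime] (hGQ : G ∈ Q) :
    IsRegularLocalRing (Localization.AtPrime Q ⧸
      Ideal.span {algebraMap (MvPolynomial (Fin (n + 2)) K) (Localization.AtPrime Q) G}) ↔
      ∃ i, (X i : MvPolynomial (Fin (n + 2)) K) ∉ Q := by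
  refine ⟨fun hreg => ?_, isRegularLocalRing_of_exists_X_not_mem K G hns Q hGQ⟩
  by_contra hall
  push Not at hall
  have hG0 : G ≠ 0 := hns.ne_zero
  exact not_isRegularLocalRing_of_forall_X_mem K G hG hd hG0 Q hall hreg

/-! ## Scheme level: the cone specimens in `ℙ³` are not regular -/

attribute [local instance] MvPolynomial.gradedAlgebra ProjBaseChange.algebraBase in
/-- **THE CONE SPECIMENS ARE NOT REGULAR SCHEMES**: for a prime plane form `G` of degree `d ≥ 2` the cone `H = V₊(G(x₁,x₂,x₃)) ⊂ ℙ³_K` is not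
a regular scheme — its vertex chart `Spec (ChartRing F 0) ≅ Spec K[y]/(G)` (`FermatCone.exists_chartQuotEquiv`, tree `SmoothHypersurface.chart`)
is an open subscheme, and `(K[y]/(G))_{𝔪₀}` is not regular since `G(0) = 0`, `∇G(0) = 0` (tree
`Resolution.not_isRegularLocalRing_localization_of_pderiv_eval_eq_zero`). Hence `Cone.elNatAt_cone` & co. are genuine ONE-step instances of EL♮,
not instances of the zero-step rung `elNatAt_of_isRegular`. [cite: Hartshorne1977, I Thm. 5.1] -/
theorem not_isRegular_hypersurface_cone (G : MvPolynomial (Fin 3) K) {d : ℕ} (hG : G.IsHomogeneous d) (hd : 2 ≤ d) (hGp : Prime G) :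
    ¬ Scheme.IsRegular (hypersurface (rename Fin.succ G : MvPolynomial (Fin 4) K)).left := by
  intro hreg
  have hF : (rename Fin.succ G : MvPolynomial (Fin 4) K).IsHomogeneous d := isHomogeneous_rename_succ K G hG
  have hd0 : 0 < d := by omega
  have hrad : (Ideal.span {G}).radical = Ideal.span {G} := ((Ideal.span_singleton_prime hGp.ne_zero).mpr hGp).radical
  obtain ⟨θ, -⟩ := FermatCone.exists_chartQuotEquiv (rename Fin.succ G : MvPolynomial (Fin 4) K) hF 0 G
    (dehomogenize_zero_rename_succ K G) hrad
  -- the vertex chart is an open subscheme of `H`, hence regular, hence its (Noetherian) coordinate ring is a regular ring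
  have h1 : Scheme.IsRegular (Spec (CommRingCat.of (ChartRing (rename Fin.succ G : MvPolynomial (Fin 4) K) 0 hF))) :=
    @Scheme.IsRegular.of_isOpenImmersion _ _ (chart (rename Fin.succ G : MvPolynomial (Fin 4) K) 0 hF hd0).left
      (isOpenImmersion_chart_left (rename Fin.succ G : MvPolynomial (Fin 4) K) 0 hF hd0) hreg
  have hN : IsNoetherianRing (ChartRing (rename Fin.succ G : MvPolynomial (Fin 4) K) 0 hF) :=
    isNoetherianRing_of_ringEquiv (MvPolynomial (Fin 3) K ⧸ Ideal.span {G}) θ.symm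
  have h2 : IsRegularRing (ChartRing (rename Fin.succ G : MvPolynomial (Fin 4) K) 0 hF) :=
    (@Scheme.isRegular_Spec_iff (CommRingCat.of (ChartRing (rename Fin.succ G : MvPolynomial (Fin 4) K) 0 hF)) hN).mp h1
  haveI : IsRegularRing (MvPolynomial (Fin 3) K ⧸ Ideal.span {G}) := IsRegularRing.of_ringEquiv θ
  -- the vertex `𝔪₀/(G)` of `K[y]/(G)` is a non-regular point
  have h0 : eval (0 : Fin 3 → K) G = 0 := eval_zero_of_isHomogeneous K G hG (by omega)
  have hle : Ideal.span {G} ≤ RingHom.ker (eval (0 : Fin 3 → K)) :=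
    (Ideal.span_singleton_le_iff_mem _).mpr ((RingHom.mem_ker).mpr h0)
  haveI h𝔫 : (RingHom.ker (eval (0 : Fin 3 → K)) : Ideal (MvPolynomial (Fin 3) K)).IsMaximal :=
    RingHom.ker_isMaximal_of_surjective (eval (0 : Fin 3 → K)) fun x => ⟨C x, eval_C x⟩
  set P : Ideal (MvPolynomial (Fin 3) K ⧸ Ideal.span {G}) :=
    (RingHom.ker (eval (0 : Fin 3 → K))).map (Ideal.Quotient.mk (Ideal.span {G})) with hP
  have hPcomap : P.comap (Ideal.Quotient.mk (Ideal.span {G})) = RingHom.ker (eval (0 : Fin 3 → K)) := by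
    rw [hP, Ideal.comap_map_of_surjective _ Ideal.Quotient.mk_surjective, ← RingHom.ker_eq_comap_bot, Ideal.mk_ker,
      sup_eq_left.mpr hle]
  haveI hPmax : P.IsMaximal := by
    refine (Ideal.map_eq_top_or_isMaximal_of_surjective _ Ideal.Quotient.mk_surjective h𝔫).resolve_left fun htop => ?_
    have h := hPcomap
    rw [hP, htop, Ideal.comap_top] at h
    exact h𝔫.ne_top h.symm
  exact not_isRegularLocalRing_localization_of_pderiv_eval_eq_zero (0 : Fin 3 → K) hGp.ne_zero h0
    (eval_zero_pderiv_of_isHomogeneous K G hG hd) P hPcomap (IsRegularRing.isRegularLocalRing_localization P)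

/-- **Instance: the Fermat cones `x₁ᵈ + x₂ᵈ + x₃ᵈ = 0`, `d ≥ 2`, `p ∤ d`, are not regular.** [folklore] -/
theorem not_isRegular_fermatCone (d : ℕ) (hd : 2 ≤ d) (hdK : (d : K) ≠ 0) :
    ¬ Scheme.IsRegular (hypersurface (rename Fin.succ (∑ i : Fin 3, (X i : MvPolynomial (Fin 3) K) ^ d) :
      MvPolynomial (Fin 4) K)).left := by
  have hG : (∑ i : Fin 3, (X i : MvPolynomial (Fin 3) K) ^ d).IsHomogeneous d :=
    IsHomogeneous.sum _ _ _ fun i _ => by simpa using (isHomogeneous_X K i).pow d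
  exact not_isRegular_hypersurface_cone K _ hG hd ((isNonsingularForm_sum_X_pow (n := 1) hdK).prime le_rfl (by omega) hG)

/-- **Instance: the quadric cone `x₁x₃ = x₂²` (the `A₁` point) is not regular, in every characteristic.** [folklore] -/
theorem not_isRegular_quadricCone :
    ¬ Scheme.IsRegular (hypersurface (rename Fin.succ (X 0 * X 2 - X 1 ^ 2 : MvPolynomial (Fin 3) K) : MvPolynomial (Fin 4) K)).left :=
  not_isRegular_hypersurface_cone K _ (isHomogeneous_quadric K) le_rfl ((isNonsingularForm_quadric K).prime le_rfl (by norm_num)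
    (isHomogeneous_quadric K))

end Cone

end Summit.ResolutionOfSingularities.ResolutionOfSingularities.Cruxes.EquisingularLiftNat.Sections

end
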